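import Summits.Parity.GeneralizedHardyLittlewood.Theses.LiouvilleShiftedTables
import Summits.Parity.GeneralizedHardyLittlewood.Theorems.TableChowla.Negative.TableChowlaExceptionalSet

/-!
# `TableChowla` (stmt-Parity-14270): the operator-norm form is equivalent to the crux

Support lemmas for the crux `LiouvilleShiftedTables.TableChowla` (cdisprove seat), proving
elementarily (no spectral theory) FACT 1 of crux idea `helson-kronecker-inverse`:
`operatorNormForm_iff : OperatorNormForm ↔ TableChowla`, where `OperatorNormForm` bounds the
bilinear form `Σ u_a v_b λ(ab+c)` by `√x/(log x)^C` for all `ℓ²`-unit test vectors `u, v`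
(the table's top singular value). Ingredients: `bilinear_sq_le`, `rowform_sq_le`
(`Σ_a (Σ_b w_b e_{ab})² ≤ ‖w‖²·√T`, two Cauchy–Schwarz steps and the column form of `T`),
`bilinear_pow_four_le` (`(uᵀMv)⁴ ≤ ‖u‖⁴‖v‖⁴·T`, i.e. `σ₁⁴ ≤ tr(MMᵀ)²`), and for the converse the
row test vectors `u = S(a,·)/√T_a`, `v = e(a,·)/√B` (`T_a ≤ B·x/(log x)^{2C}` per row). [folklore]
-/

namespace Summit.Parity.GeneralizedHardyLittlewood.Theorems.TableChowla.Negative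

open Finset Real ArithmeticFunction
open Summit.Parity.GeneralizedHardyLittlewood.Theses

noncomputable section

variable {f : ℕ → ℝ} {c : ℤ} {A₁ A₂ B : ℕ}

/-- Cauchy–Schwarz in the row variable: `(Σ_{a,b} u_a v_b e_{ab})² ≤ (Σ_a u_a²)·Σ_a (Σ_b v_b e_{ab})²`. -/
theorem bilinear_sq_le (u v : ℕ → ℝ) :
    (∑ a ∈ Ioc A₁ A₂, ∑ b ∈ Icc 1 B, u a * v b * f (Int.toNat ((a : ℤ) * b + c))) ^ 2 ≤
      (∑ a ∈ Ioc A₁ A₂, u a ^ 2) *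
        ∑ a ∈ Ioc A₁ A₂, (∑ b ∈ Icc 1 B, v b * f (Int.toNat ((a : ℤ) * b + c))) ^ 2 := by
  have h := sum_mul_sq_le_sq_mul_sq (Ioc A₁ A₂) u (fun a => ∑ b ∈ Icc 1 B, v b * f (Int.toNat ((a : ℤ) * b + c)))
  refine le_trans (le_of_eq ?_) h
  congr 1
  refine sum_congr rfl fun a _ => ?_
  rw [mul_sum]
  refine sum_congr rfl fun b _ => ?_
  ring

/-- Two more Cauchy–Schwarz steps and the column form of the moment:
`Σ_a (Σ_b w_b e_{ab})² ≤ (Σ_b w_b²)·√T` — the row Gram form is dominated by `‖w‖²·‖MᵀM‖_F`. -/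
theorem rowform_sq_le (w : ℕ → ℝ) :
    ∑ a ∈ Ioc A₁ A₂, (∑ b ∈ Icc 1 B, w b * f (Int.toNat ((a : ℤ) * b + c))) ^ 2 ≤
      (∑ b ∈ Icc 1 B, w b ^ 2) * Real.sqrt (momentN f c A₁ A₂ B) := by
  set e : ℕ → ℕ → ℝ := fun a b => f (Int.toNat ((a : ℤ) * b + c)) with he
  set G : ℕ → ℕ → ℝ := fun b b' => ∑ a ∈ Ioc A₁ A₂, e a b * e a b' with hG
  set z : ℕ → ℝ := fun b => ∑ b' ∈ Icc 1 B, G b b' * w b' with hz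
  -- (1) Σ_a (Σ_b w e)² = Σ_b w_b z_b
  have h1 : ∑ a ∈ Ioc A₁ A₂, (∑ b ∈ Icc 1 B, w b * e a b) ^ 2 = ∑ b ∈ Icc 1 B, w b * z b := by
    simp only [hz, hG]
    simp_rw [sq, sum_mul_sum, mul_sum]
    rw [sum_comm]
    refine sum_congr rfl fun b _ => ?_
    rw [sum_comm]
    refine sum_congr rfl fun b' _ => ?_
    rw [sum_mul, mul_sum]
    refine sum_congr rfl fun a _ => ?_
    ring
  -- (2) (Σ_b w z)² ≤ (Σ w²)(Σ z²)
  have h2 : (∑ b ∈ Icc 1 B, w b * z b) ^ 2 ≤ (∑ b ∈ Icc 1 B, w b ^ 2) * ∑ b ∈ Icc 1 B, z b ^ 2 :=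
    sum_mul_sq_le_sq_mul_sq _ _ _
  -- (3) Σ_b z_b² ≤ (Σ w²) · T  (CS in b' for each b, then the column form of T)
  have h3 : ∑ b ∈ Icc 1 B, z b ^ 2 ≤ (∑ b ∈ Icc 1 B, w b ^ 2) * momentN f c A₁ A₂ B := by
    have hcol : momentN f c A₁ A₂ B = ∑ b ∈ Icc 1 B, ∑ b' ∈ Icc 1 B, G b b' ^ 2 := by
      rw [momentN_eq_colMoment]
    rw [hcol, mul_sum]
    refine sum_le_sum fun b _ => ?_
    simp only [hz]
    calc (∑ b' ∈ Icc 1 B, G b b' * w b') ^ 2 ≤ (∑ b' ∈ Icc 1 B, G b b' ^ 2) * ∑ b' ∈ Icc 1 B, w b' ^ 2 :=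
          sum_mul_sq_le_sq_mul_sq _ _ _
      _ = (∑ b' ∈ Icc 1 B, w b' ^ 2) * ∑ b' ∈ Icc 1 B, G b b' ^ 2 := by ring
  -- combine: LHS = Σ w z ≤ √((Σw²)(Σz²)) ≤ √((Σw²)² T) = (Σw²) √T
  have hW : 0 ≤ ∑ b ∈ Icc 1 B, w b ^ 2 := sum_nonneg fun _ _ => sq_nonneg _
  have hT : 0 ≤ momentN f c A₁ A₂ B := momentN_nonneg
  rw [h1]
  have h4 : (∑ b ∈ Icc 1 B, w b * z b) ^ 2 ≤ ((∑ b ∈ Icc 1 B, w b ^ 2) * Real.sqrt (momentN f c A₁ A₂ B)) ^ 2 := by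
    calc (∑ b ∈ Icc 1 B, w b * z b) ^ 2 ≤ (∑ b ∈ Icc 1 B, w b ^ 2) * ∑ b ∈ Icc 1 B, z b ^ 2 := h2
      _ ≤ (∑ b ∈ Icc 1 B, w b ^ 2) * ((∑ b ∈ Icc 1 B, w b ^ 2) * momentN f c A₁ A₂ B) :=
          mul_le_mul_of_nonneg_left h3 hW
      _ = ((∑ b ∈ Icc 1 B, w b ^ 2) * Real.sqrt (momentN f c A₁ A₂ B)) ^ 2 := by
          rw [mul_pow, Real.sq_sqrt hT]; ring
  exact (abs_le_of_sq_le_sq' h4 (by positivity)).2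

/-- `σ₁⁴ ≤ tr(MMᵀ)²`, scaled: `(Σ_{a,b} u_a v_b e_{ab})⁴ ≤ (Σu²)²(Σv²)²·T`. -/
theorem bilinear_pow_four_le (u v : ℕ → ℝ) :
    (∑ a ∈ Ioc A₁ A₂, ∑ b ∈ Icc 1 B, u a * v b * f (Int.toNat ((a : ℤ) * b + c))) ^ 4 ≤
      (∑ a ∈ Ioc A₁ A₂, u a ^ 2) ^ 2 * (∑ b ∈ Icc 1 B, v b ^ 2) ^ 2 * momentN f c A₁ A₂ B := by
  have h1 := bilinear_sq_le (f := f) (c := c) (A₁ := A₁) (A₂ := A₂) (B := B) u v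
  have h2 := rowform_sq_le (f := f) (c := c) (A₁ := A₁) (A₂ := A₂) (B := B) v
  have hU : 0 ≤ ∑ a ∈ Ioc A₁ A₂, u a ^ 2 := sum_nonneg fun _ _ => sq_nonneg _
  have hV : 0 ≤ ∑ b ∈ Icc 1 B, v b ^ 2 := sum_nonneg fun _ _ => sq_nonneg _
  have hT : 0 ≤ momentN f c A₁ A₂ B := momentN_nonneg
  have h3 : (∑ a ∈ Ioc A₁ A₂, ∑ b ∈ Icc 1 B, u a * v b * f (Int.toNat ((a : ℤ) * b + c))) ^ 2 ≤
      (∑ a ∈ Ioc A₁ A₂, u a ^ 2) * ((∑ b ∈ Icc 1 B, v b ^ 2) * Real.sqrt (momentN f c A₁ A₂ B)) :=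
    le_trans h1 (mul_le_mul_of_nonneg_left h2 hU)
  have h0 : 0 ≤ (∑ a ∈ Ioc A₁ A₂, ∑ b ∈ Icc 1 B, u a * v b * f (Int.toNat ((a : ℤ) * b + c))) ^ 2 := sq_nonneg _
  calc (∑ a ∈ Ioc A₁ A₂, ∑ b ∈ Icc 1 B, u a * v b * f (Int.toNat ((a : ℤ) * b + c))) ^ 4
      = ((∑ a ∈ Ioc A₁ A₂, ∑ b ∈ Icc 1 B, u a * v b * f (Int.toNat ((a : ℤ) * b + c))) ^ 2) ^ 2 := by ring
    _ ≤ ((∑ a ∈ Ioc A₁ A₂, u a ^ 2) * ((∑ b ∈ Icc 1 B, v b ^ 2) * Real.sqrt (momentN f c A₁ A₂ B))) ^ 2 :=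
        pow_le_pow_left₀ h0 h3 2
    _ = (∑ a ∈ Ioc A₁ A₂, u a ^ 2) ^ 2 * (∑ b ∈ Icc 1 B, v b ^ 2) ^ 2 * momentN f c A₁ A₂ B := by
        rw [mul_pow, mul_pow, Real.sq_sqrt hT]; ring

/-- The table entry `λ(ab+c)` (as in crux idea `helson-kronecker-inverse`). -/
noncomputable def entry (c : ℤ) (a b : ℕ) : ℝ :=
  (ArithmeticFunction.liouville (Int.toNat ((a : ℤ) * b + c)) : ℝ)

/-- OPERATOR-NORM FORM of the crux (verbatim the `OperatorNormForm` of crux idea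
`helson-kronecker-inverse`): every `ℓ²`-unit pair of test vectors sees `|uᵀMv| ≤ √x/(log x)^C`. -/
def OperatorNormForm : Prop :=
  ∀ c : ℤ, c ≠ 0 → ∀ δ : ℝ, 0 < δ → δ ≤ 1 / 12 → ∀ C : ℝ, 0 < C → ∃ x₀ : ℝ, ∀ x : ℝ, x₀ ≤ x →
    ∀ A : ℝ, x ^ δ ≤ A → A ≤ x ^ (1 / 3 + δ) →
    ∀ u v : ℕ → ℝ, (∑ a ∈ Finset.Ioc ⌊A⌋₊ ⌊2 * A⌋₊, u a ^ 2 ≤ 1) →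
      (∑ b ∈ Finset.Icc 1 ⌊x / A⌋₊, v b ^ 2 ≤ 1) →
      |∑ a ∈ Finset.Ioc ⌊A⌋₊ ⌊2 * A⌋₊, ∑ b ∈ Finset.Icc 1 ⌊x / A⌋₊, u a * v b * entry c a b| ≤
        x ^ (1 / 2 : ℝ) / Real.log x ^ C

/-- `entry` is the table entry for `λ`. -/
theorem entry_eq (c : ℤ) (a b : ℕ) : entry c a b = lam (Int.toNat ((a : ℤ) * b + c)) := rfl

/-- `TableChowla → OperatorNormForm` (`|uᵀMv| ≤ T^{1/4}`, crux at level `4C`). -/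
theorem operatorNormForm_of_tableChowla (h : LiouvilleShiftedTables.TableChowla) : OperatorNormForm := by
  intro c hc δ hδ hδ' C hC
  obtain ⟨x₀, hx₀⟩ := (tableChowla_iff.mp h) c hc δ hδ hδ' (4 * C) (by positivity)
  refine ⟨max x₀ 1, fun x hx A hA hA' u v hu hv => ?_⟩
  have hx₀x : x₀ ≤ x := le_trans (le_max_left _ _) hx
  have hx1 : 1 ≤ x := le_trans (le_max_right _ _) hx
  have hxpos : 0 < x := by linarith
  have hlog0 : 0 ≤ Real.log x := Real.log_nonneg hx1
  have key := hx₀ x hx₀x A hA hA'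
  set X : ℝ := ∑ a ∈ Finset.Ioc ⌊A⌋₊ ⌊2 * A⌋₊, ∑ b ∈ Finset.Icc 1 ⌊x / A⌋₊, u a * v b * entry c a b with hX
  have h4 := bilinear_pow_four_le (f := lam) (c := c) (A₁ := ⌊A⌋₊) (A₂ := ⌊2 * A⌋₊) (B := ⌊x / A⌋₊) u v
  simp only [← entry_eq] at h4
  rw [← hX] at h4
  have hmom : momentN lam c ⌊A⌋₊ ⌊2 * A⌋₊ ⌊x / A⌋₊ = moment lam c x A := rfl
  rw [hmom] at h4
  have hU0 : 0 ≤ ∑ a ∈ Finset.Ioc ⌊A⌋₊ ⌊2 * A⌋₊, u a ^ 2 := sum_nonneg fun _ _ => sq_nonneg _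
  have hV0 : 0 ≤ ∑ b ∈ Finset.Icc 1 ⌊x / A⌋₊, v b ^ 2 := sum_nonneg fun _ _ => sq_nonneg _
  have hT0 : 0 ≤ moment lam c x A := momentN_nonneg
  -- X⁴ ≤ 1·1·T ≤ x²/(log x)^{4C} = (√x/(log x)^C)⁴
  have hX4 : X ^ 4 ≤ (x ^ ((1 : ℝ) / 2) / Real.log x ^ C) ^ 4 := by
    calc X ^ 4 ≤ (∑ a ∈ Finset.Ioc ⌊A⌋₊ ⌊2 * A⌋₊, u a ^ 2) ^ 2 * (∑ b ∈ Finset.Icc 1 ⌊x / A⌋₊, v b ^ 2) ^ 2 *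
          moment lam c x A := h4
      _ ≤ 1 ^ 2 * 1 ^ 2 * moment lam c x A := by
          apply mul_le_mul_of_nonneg_right _ hT0
          exact mul_le_mul (pow_le_pow_left₀ hU0 hu 2) (pow_le_pow_left₀ hV0 hv 2) (by positivity) (by positivity)
      _ ≤ x ^ 2 / Real.log x ^ (4 * C) := by rw [one_pow, one_mul, one_mul]; exact key
      _ = (x ^ ((1 : ℝ) / 2) / Real.log x ^ C) ^ 4 := by
          rw [div_pow, ← Real.rpow_natCast (x ^ ((1:ℝ)/2)) 4, ← Real.rpow_mul hxpos.le,
            ← Real.rpow_natCast (Real.log x ^ C) 4, ← Real.rpow_mul hlog0]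
          norm_num
          rw [mul_comm C 4]
  have hR0 : 0 ≤ x ^ ((1 : ℝ) / 2) / Real.log x ^ C := by positivity
  have habs : |X| ^ 4 ≤ (x ^ ((1 : ℝ) / 2) / Real.log x ^ C) ^ 4 := by
    rwa [show |X| ^ 4 = X ^ 4 by rw [show (4 : ℕ) = 2 * 2 by norm_num, pow_mul, pow_mul, sq_abs]]
  exact (pow_le_pow_iff_left₀ (abs_nonneg X) hR0 (by norm_num)).mp habs

/-- `OperatorNormForm → TableChowla` (test vectors `u = S(a,·)/√T_a`, `v = e(a,·)/√B` give
`T_a ≤ B·x/(log x)^{2C}` per row; sum over `≤ 2A` rows). -/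
theorem tableChowla_of_operatorNormForm' (h : OperatorNormForm) : LiouvilleShiftedTables.TableChowla := by
  rw [tableChowla_iff]
  intro c hc δ hδ hδ' C hC
  obtain ⟨x₀, hx₀⟩ := h c hc δ hδ hδ' C hC
  obtain ⟨X₂, hX₂⟩ := eventually_rpow_log_ge hC 2
  refine ⟨max x₀ (max X₂ 1), fun x hx A hA hA' => ?_⟩
  have hx₀x : x₀ ≤ x := le_trans (le_max_left _ _) hx
  have hxX₂ : X₂ ≤ x := le_trans (le_trans (le_max_left _ _) (le_max_right _ _)) hx
  have hx1 : 1 ≤ x := le_trans (le_trans (le_max_right _ _) (le_max_right _ _)) hx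
  have hxpos : 0 < x := by linarith
  obtain ⟨hL2, hlog2⟩ := hX₂ x hxX₂
  have hlogpos : 0 < Real.log x := by linarith
  set L : ℝ := Real.log x ^ C with hL
  have hLpos : 0 < L := Real.rpow_pos_of_pos hlogpos C
  obtain ⟨hRB, _⟩ := rows_mul_cols_le_window hx1 hδ.le (by linarith) hA hA'
  set I : Finset ℕ := Finset.Ioc ⌊A⌋₊ ⌊2 * A⌋₊ with hI
  set Bn : ℕ := ⌊x / A⌋₊ with hBn
  set e : ℕ → ℕ → ℝ := fun a b => entry c a b with he
  -- per-row bound: T_a ≤ Bn · x / L²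
  have hrow : ∀ a ∈ I, ∑ a' ∈ I, rowCorr lam c Bn a a' ^ 2 ≤ (Bn : ℝ) * x / L ^ 2 := by
    intro a ha
    set Ta : ℝ := ∑ a' ∈ I, rowCorr lam c Bn a a' ^ 2 with hTa
    have hTa0 : 0 ≤ Ta := sum_nonneg fun _ _ => sq_nonneg _
    rcases hTa0.eq_or_lt with hzero | hpos
    · rw [← hzero]; positivity
    have hBpos : (0 : ℝ) < Bn := by
      -- if Bn = 0 then every rowCorr is an empty sum, Ta = 0
      by_contra hB
      have hB0 : Bn = 0 := by
        have : (Bn : ℝ) ≤ 0 := le_of_not_gt hB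
        exact_mod_cast le_antisymm (by exact_mod_cast this) (Nat.zero_le _)
      have : Ta = 0 := by
        rw [hTa]; refine sum_eq_zero fun a' _ => ?_
        simp [rowCorr, hB0]
      linarith
    -- test vectors
    set u : ℕ → ℝ := fun a' => rowCorr lam c Bn a a' / Real.sqrt Ta with hu
    set v : ℕ → ℝ := fun b => e a b / Real.sqrt Bn with hv
    have hsqTa : 0 < Real.sqrt Ta := Real.sqrt_pos.mpr hpos
    have hsqB : 0 < Real.sqrt Bn := Real.sqrt_pos.mpr hBpos
    have hu1 : ∑ a' ∈ I, u a' ^ 2 ≤ 1 := by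
      simp only [hu, div_pow, Real.sq_sqrt hTa0]
      rw [← sum_div, ← hTa, div_self hpos.ne']
    have hv1 : ∑ b ∈ Finset.Icc 1 Bn, v b ^ 2 ≤ 1 := by
      simp only [hv, div_pow, Real.sq_sqrt hBpos.le]
      rw [← sum_div, div_le_one hBpos]
      calc ∑ b ∈ Finset.Icc 1 Bn, e a b ^ 2 ≤ ∑ _b ∈ Finset.Icc 1 Bn, (1 : ℝ) :=
            sum_le_sum fun b _ => by simp only [he, entry_eq]; exact lam_sq_le_one _
        _ = Bn := by simp
    have key := hx₀ x hx₀x A hA hA' u v hu1 (by rw [← hBn]; exact hv1)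
    rw [← hI, ← hBn] at key
    -- the bilinear form equals √Ta / √Bn · (1) : Σ_{a',b} u a' v b e a' b = (1/(√Ta √Bn)) Σ_{a'} S(a,a') S(a',a)
    have hform : ∑ a' ∈ I, ∑ b ∈ Finset.Icc 1 Bn, u a' * v b * entry c a' b = Real.sqrt Ta / Real.sqrt Bn := by
      have hS : ∀ a', ∑ b ∈ Finset.Icc 1 Bn, u a' * v b * entry c a' b =
          u a' / Real.sqrt Bn * rowCorr lam c Bn a a' := by
        intro a'
        unfold rowCorr
        rw [mul_sum]
        refine sum_congr rfl fun b _ => ?_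
        simp only [hv, he, entry_eq]
        ring
      simp_rw [hS]
      simp only [hu]
      have : ∑ a' ∈ I, rowCorr lam c Bn a a' / Real.sqrt Ta / Real.sqrt Bn * rowCorr lam c Bn a a' =
          (∑ a' ∈ I, rowCorr lam c Bn a a' ^ 2) / (Real.sqrt Ta * Real.sqrt Bn) := by
        rw [sum_div]; refine sum_congr rfl fun a' _ => ?_; field_simp
      rw [this, ← hTa]
      rw [div_eq_div_iff (by positivity) (by positivity)]
      calc Ta * Real.sqrt Bn = Real.sqrt Ta ^ 2 * Real.sqrt Bn := by rw [Real.sq_sqrt hTa0]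
        _ = Real.sqrt Ta * (Real.sqrt Ta * Real.sqrt Bn) := by ring
    rw [hform, abs_of_nonneg (by positivity)] at key
    -- √Ta/√Bn ≤ √x / L  ⟹ Ta ≤ Bn x / L²
    have hsq : Ta / Bn ≤ x / L ^ 2 := by
      have h1 : (Real.sqrt Ta / Real.sqrt Bn) ^ 2 ≤ (x ^ ((1 : ℝ) / 2) / L) ^ 2 :=
        pow_le_pow_left₀ (by positivity) key 2
      rw [div_pow, div_pow, Real.sq_sqrt hTa0, Real.sq_sqrt hBpos.le, ← Real.rpow_natCast (x ^ ((1:ℝ)/2)) 2,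
        ← Real.rpow_mul hxpos.le] at h1
      norm_num at h1
      exact h1
    rw [div_le_div_iff₀ hBpos (by positivity)] at hsq
    rw [le_div_iff₀ (by positivity)]
    linarith
  -- sum over rows: T ≤ rows · Bn x/L² ≤ 2x · x / L² ≤ x²/L (L ≥ 2)
  have hT : momentN lam c ⌊A⌋₊ ⌊2 * A⌋₊ Bn ≤ (I.card : ℝ) * ((Bn : ℝ) * x / L ^ 2) := by
    unfold momentN
    rw [← hI]
    calc ∑ a ∈ I, ∑ a' ∈ I, rowCorr lam c Bn a a' ^ 2 ≤ ∑ _a ∈ I, (Bn : ℝ) * x / L ^ 2 := sum_le_sum hrow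
      _ = (I.card : ℝ) * ((Bn : ℝ) * x / L ^ 2) := by rw [sum_const, nsmul_eq_mul]
  have hIB : (I.card : ℝ) * Bn ≤ 2 * x := by rw [hI, Nat.card_Ioc]; exact hRB
  show momentN lam c ⌊A⌋₊ ⌊2 * A⌋₊ ⌊x / A⌋₊ ≤ x ^ 2 / L
  rw [← hBn]
  calc momentN lam c ⌊A⌋₊ ⌊2 * A⌋₊ Bn ≤ (I.card : ℝ) * ((Bn : ℝ) * x / L ^ 2) := hT
    _ = ((I.card : ℝ) * Bn) * x / L ^ 2 := by ring
    _ ≤ (2 * x) * x / L ^ 2 := by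
        apply div_le_div_of_nonneg_right _ (by positivity)
        exact mul_le_mul_of_nonneg_right hIB hxpos.le
    _ ≤ x ^ 2 / L := by
        rw [div_le_div_iff₀ (by positivity) hLpos]
        nlinarith [mul_nonneg (sq_nonneg x) hLpos.le]

/-- FACT 1 of crux idea `helson-kronecker-inverse`, PROVED: `OperatorNormForm ↔ TableChowla`. -/
theorem operatorNormForm_iff : OperatorNormForm ↔ LiouvilleShiftedTables.TableChowla :=
  ⟨tableChowla_of_operatorNormForm', operatorNormForm_of_tableChowla⟩

end

end Summit.Parity.GeneralizedHardyLittlewood.Theorems.TableChowla.Negative
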